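import Literature.Analysis.FluidPDE.LeiZhang2011StreamLimit
import Literature.Analysis.FunctionSpaces.BMOWeakCompactness
import Literature.Analysis.FunctionSpaces.BMOProofs
import HarnessLib

/-!
# Lei–Zhang 2011, Theorem 1.4: the blow-up limit has a distributional `BMO` stream function

Analysis/FluidPDE **proofs file** (theorems only: no definitions, no named facts, no `sorry`) on
the discharge path of the named fact
`Literature.Analysis.FluidPDE.LeiZhang2011_regularity_bmoStream` (Z. Lei, Q. S. Zhang,
J. Funct. Anal. 261 (2011) = arXiv:1011.5066, **Theorem 1.4**, proof §4, Case 1, p. 12: "both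
the stream function and `r v^θ` are scaling invariant. Thus the stream function of `u` is in
BMO … Therefore we can apply Theorem 1.1 on `u`"). For the blow-up limit `u` of the rescaled
velocities `w_k` this sentence needs a stream function *of the limit*; the rescaled stream
functions `B_k` are only bounded in `BMO` (`HasBMOStreamFunctionOn.rescale`). This file constructs
it:

* `exists_bmoStream_of_tendstoUniformlyOn` — if `curl B_k = w_k` a.e. for differentiable `B_k`
  with `‖B_k‖_{BMO} ≤ K` and `w_k → u` uniformly on balls, then `u` has a **distributional stream
  function in `BMO`**: a locally integrable `B_u` with `‖B_u‖_{BMO} ≤ 6K` and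
  `∫ φ ⟪u, e⟫ = ∫ ⟪B_u × ∇φ, e⟫` for all `φ ∈ C¹_c(ℝ³)`, `e ∈ ℝ³` (weak compactness of `BMO`
  modulo constants, `BMOWeakCompactness`, applied to the three components along nested
  subsequences; the identity `integral_mul_inner_eq_integral_inner_cross_gradient` in components,
  constants being killed by `∫ ∇φ = 0`, passes to the limit on both sides);
* `tendsto_integral_mul_inner_of_tendstoUniformlyOn` — pairings with continuous compactly
  supported functions pass to uniform limits on balls;
* `memBMO_inner_single_of_eBMOSeminormVec_le`, `inner_cross_left_eq_sum` — helpers.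

The output class (locally integrable `B_u`, `BMO` bound, `curl B_u = u` in `𝓓'`) is the one in
which Theorem 1.1 of the paper uses the stream function (integration by parts against `B − B̄`),
and it is the hypothesis class of the swirl step in the conditional assembly of Theorem 1.4.

## Mathlib / tree search

Reused: `exists_subseq_tendsto_integral_mul_continuous_of_eBMOSeminorm_le`
(`BMOWeakCompactness`), `integral_mul_inner_eq_integral_inner_cross_gradient`,
`inner_cross_right_eq_inner_cross_left` (`DifferentiableGaussGreen`), `apply_eq_inner_single`
(`LeiZhang2011StreamLimit`), `memBMO_inner_of_eBMOSeminormVec_lt_top`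
(`LeiZhang2011RegularityProofs`), `eBMOSeminorm_sum_le'`, `eBMOSeminorm_const_mul_le`
(`BMOInvProofs`), `curl_eq_zero_of_fderiv_eq_zero` (`VorticityCalculus`),
`continuous_gradient_of_contDiff`, `gradient_eq_zero_of_notMem_tsupport` (`WholeSpaceIBP`).

## References

* Z. Lei, Q. S. Zhang, J. Funct. Anal. 261 (2011) = arXiv:1011.5066: Thm. 1.4, proof §4, Case 1
  (p. 12). [LeiZhang2011]
-/

noncomputable section

open MeasureTheory Set Function Filter Topology TopologicalSpace Metric
open scoped InnerProductSpace RealInnerProductSpace NNReal ENNReal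

namespace Literature.Analysis.FluidPDE

open Literature.Analysis.FunctionSpaces

/-! ### Pairings with continuous compactly supported functions pass to uniform limits -/

/-- If `w_k → u` uniformly on every closed ball (all locally integrable) and `φ` is continuous
with compact support, then `∫ φ ⟪w_k, e⟫ → ∫ φ ⟪u, e⟫`. [folklore] -/
theorem tendsto_integral_mul_inner_of_tendstoUniformlyOn
    {w : ℕ → EuclideanSpace ℝ (Fin 3) → EuclideanSpace ℝ (Fin 3)}
    {u : EuclideanSpace ℝ (Fin 3) → EuclideanSpace ℝ (Fin 3)}
    (hw : ∀ k, LocallyIntegrable (w k) volume) (hu : LocallyIntegrable u volume)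
    (hconv : ∀ r : ℝ, 0 < r →
      TendstoUniformlyOn w u atTop (closedBall (0 : EuclideanSpace ℝ (Fin 3)) r))
    {φ : EuclideanSpace ℝ (Fin 3) → ℝ} (hφ : Continuous φ) (hφc : HasCompactSupport φ)
    (e : EuclideanSpace ℝ (Fin 3)) :
    Tendsto (fun k => ∫ x, φ x * ⟪w k x, e⟫) atTop (𝓝 (∫ x, φ x * ⟪u x, e⟫)) := by
  obtain ⟨M, hM⟩ := hφ.bounded_above_of_compact_support hφc
  obtain ⟨R, hRpos, hR⟩ := hφc.exists_pos_le_norm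
  have hφ0 : ∀ x, x ∉ closedBall (0 : EuclideanSpace ℝ (Fin 3)) R → φ x = 0 := fun x hx =>
    hR x (by simp only [mem_closedBall, dist_zero_right, not_le] at hx; exact hx.le)
  have hint : ∀ v : EuclideanSpace ℝ (Fin 3) → EuclideanSpace ℝ (Fin 3),
      LocallyIntegrable v volume → Integrable (fun x => φ x * ⟪v x, e⟫) := fun v hv => by
    have := (hv.integrable_smul_left_of_hasCompactSupport hφ hφc).inner_const (𝕜 := ℝ) e
    refine this.congr (Eventually.of_forall fun x => ?_)
    simp only [real_inner_smul_left]
  set V : ℝ := volume.real (closedBall (0 : EuclideanSpace ℝ (Fin 3)) R) with hV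
  have hM0 : 0 ≤ M := (norm_nonneg _).trans (hM 0)
  rw [Metric.tendsto_atTop]
  intro ε hε
  obtain ⟨δ, hδ, hδε⟩ : ∃ δ : ℝ, 0 < δ ∧ δ * (M * ‖e‖ * V) < ε := by
    refine ⟨ε / (M * ‖e‖ * V + 1), div_pos hε (by positivity), ?_⟩
    rw [div_mul_eq_mul_div, div_lt_iff₀ (by positivity)]
    nlinarith [norm_nonneg e, (measureReal_nonneg : 0 ≤ V)]
  obtain ⟨N, hN⟩ := eventually_atTop.1 ((Metric.tendstoUniformlyOn_iff.1 (hconv R hRpos)) δ hδ)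
  refine ⟨N, fun k hk => ?_⟩
  rw [dist_eq_norm, ← integral_sub (hint _ (hw k)) (hint _ hu)]
  have hpt : ∀ x, φ x * ⟪w k x, e⟫ - φ x * ⟪u x, e⟫ = φ x * ⟪w k x - u x, e⟫ := fun x => by
    rw [inner_sub_left, mul_sub]
  simp_rw [hpt]
  have hbound : ∀ x, ‖φ x * ⟪w k x - u x, e⟫‖ ≤
      (closedBall (0 : EuclideanSpace ℝ (Fin 3)) R).indicator (fun _ => M * (δ * ‖e‖)) x := by
    intro x
    by_cases hx : x ∈ closedBall (0 : EuclideanSpace ℝ (Fin 3)) R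
    · rw [indicator_of_mem hx, norm_mul]
      have h2 : ‖w k x - u x‖ ≤ δ := by
        rw [← dist_eq_norm, dist_comm]; exact (hN k hk x hx).le
      calc ‖φ x‖ * ‖⟪w k x - u x, e⟫‖ ≤ M * (‖w k x - u x‖ * ‖e‖) := by
            gcongr
            · exact hM x
            · exact norm_inner_le_norm _ _
        _ ≤ M * (δ * ‖e‖) := by gcongr
    · rw [indicator_of_notMem hx, hφ0 x hx]
      simp
  calc ‖∫ x, φ x * ⟪w k x - u x, e⟫‖
      ≤ ∫ x, (closedBall (0 : EuclideanSpace ℝ (Fin 3)) R).indicator (fun _ => M * (δ * ‖e‖)) x :=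
        norm_integral_le_of_norm_le
          ((integrableOn_const (measure_closedBall_lt_top).ne).integrable_indicator
            measurableSet_closedBall) (Eventually.of_forall hbound)
    _ = δ * (M * ‖e‖ * V) := by
        rw [integral_indicator measurableSet_closedBall, setIntegral_const, smul_eq_mul, hV]; ring
    _ < ε := hδε

/-! ### Components of `BMO` stream functions -/

/-- The component `x ↦ ⟪B x, eᵢ⟫` of a continuous field with `‖B‖_{BMO} ≤ K` is a `BMO` function
with seminorm `≤ K`. [folklore] -/
theorem memBMO_inner_single_of_eBMOSeminormVec_le
    {B : EuclideanSpace ℝ (Fin 3) → EuclideanSpace ℝ (Fin 3)} (hB : Continuous B) {K : ℝ≥0}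
    (hK : eBMOSeminormVec B ≤ K) (i : Fin 3) :
    MemBMO (fun x => ⟪B x, EuclideanSpace.single i (1 : ℝ)⟫) volume ∧
      eBMOSeminorm (fun x => ⟪B x, EuclideanSpace.single i (1 : ℝ)⟫) volume ≤ K := by
  have h1 : eBMOSeminorm (fun x => ⟪B x, EuclideanSpace.single i (1 : ℝ)⟫) volume ≤
      eBMOSeminormVec B := le_iSup₂_of_le (EuclideanSpace.single i (1 : ℝ)) (by simp) le_rfl
  exact ⟨memBMO_inner_of_eBMOSeminormVec_lt_top hB.locallyIntegrable
    (hK.trans_lt ENNReal.coe_lt_top) _, h1.trans hK⟩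

/-- `⟪B × g, e⟫ = Σᵢ ⟪B, eᵢ⟫ (g × e)ᵢ`. [folklore] -/
theorem inner_cross_left_eq_sum (B g e : EuclideanSpace ℝ (Fin 3)) :
    ⟪cross B g, e⟫ = ∑ i, ⟪B, EuclideanSpace.single i (1 : ℝ)⟫ * (cross g e) i := by
  rw [← inner_cross_right_eq_inner_cross_left]
  have h : ⟪B, cross g e⟫ = ∑ i, B i * (cross g e) i := by
    simp [PiLp.inner_apply, mul_comm]
  rw [h]
  refine Finset.sum_congr rfl fun i _ => ?_
  rw [← apply_eq_inner_single]

/-! ### The limit stream function -/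

/-- **The blow-up limit has a distributional `BMO` stream function.** Let `w_k : ℝ³ → ℝ³` have
differentiable stream functions `B_k` (`curl B_k = w_k` a.e.) with a uniform bound
`‖B_k‖_{BMO} ≤ K`, and let `w_k → u` uniformly on every ball (all fields locally integrable).
Then `u` has a stream function in `𝓓'` with `BMO` bound `6K`: a locally integrable `B_u` with
`‖B_u‖_{BMO} ≤ 6K` and `∫ φ ⟪u, e⟫ = ∫ ⟪B_u × ∇φ, e⟫` for all `φ ∈ C¹_c`, `e`. Proof: the
components `⟪B_k, eᵢ⟫` are bounded in `BMO`; by the weak compactness of `BMO` modulo constants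
(`exists_subseq_tendsto_integral_mul_continuous_of_eBMOSeminorm_le`, `BMOWeakCompactness`, along
nested subsequences for `i = 0, 1, 2`) they converge modulo constants to `gᵢ ∈ BMO`,
`‖gᵢ‖_* ≤ 2K`; with `B_u = Σ gᵢ eᵢ`, the identity `∫ φ ⟪w_k, e⟫ = ∫ ⟪(B_k − c_k) × ∇φ, e⟫ =
Σᵢ ∫ (⟪B_k, eᵢ⟫ − cᵢ)(∇φ × e)ᵢ` (`integral_mul_inner_eq_integral_inner_cross_gradient`; constants
are killed by `∫ ∇φ = 0`) passes to the limit on both sides. This is the formal content of "the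
stream function … is scaling invariant. Thus the stream function of `u` is in BMO" for the
blow-up limit `u` (Lei–Zhang, arXiv:1011.5066 p. 12); it is the input of Theorem 1.1 in Case 1
of the proof of Theorem 1.4. [cite: LeiZhang2011, Thm. 1.4, proof §4, Case 1 (arXiv p. 12)] -/
theorem exists_bmoStream_of_tendstoUniformlyOn
    {B w : ℕ → EuclideanSpace ℝ (Fin 3) → EuclideanSpace ℝ (Fin 3)}
    {u : EuclideanSpace ℝ (Fin 3) → EuclideanSpace ℝ (Fin 3)} {K : ℝ≥0}
    (hB : ∀ k, Differentiable ℝ (B k)) (hcurl : ∀ k, curl (B k) =ᵐ[volume] w k)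
    (hbmo : ∀ k, eBMOSeminormVec (B k) ≤ K) (hw : ∀ k, LocallyIntegrable (w k) volume)
    (hu : LocallyIntegrable u volume)
    (hconv : ∀ r : ℝ, 0 < r →
      TendstoUniformlyOn w u atTop (closedBall (0 : EuclideanSpace ℝ (Fin 3)) r)) :
    ∃ Bu : EuclideanSpace ℝ (Fin 3) → EuclideanSpace ℝ (Fin 3), LocallyIntegrable Bu volume ∧
      eBMOSeminormVec Bu ≤ 6 * K ∧
      ∀ (φ : EuclideanSpace ℝ (Fin 3) → ℝ) (e : EuclideanSpace ℝ (Fin 3)),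
        ContDiff ℝ 1 φ → HasCompactSupport φ →
          ∫ x, φ x * ⟪u x, e⟫ = ∫ x, ⟪cross (Bu x) (gradient φ x), e⟫ := by
  -- the components and their bounds
  set f : Fin 3 → ℕ → EuclideanSpace ℝ (Fin 3) → ℝ :=
    fun i k x => ⟪B k x, EuclideanSpace.single i (1 : ℝ)⟫ with hf
  have hfBMO : ∀ i k, MemBMO (f i k) volume := fun i k =>
    (memBMO_inner_single_of_eBMOSeminormVec_le (hB k).continuous (hbmo k) i).1
  have hfK : ∀ i k, eBMOSeminorm (f i k) volume ≤ K := fun i k =>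
    (memBMO_inner_single_of_eBMOSeminormVec_le (hB k).continuous (hbmo k) i).2
  -- three nested extractions
  obtain ⟨σ₀, hσ₀, g₀, hg₀m, hg₀, hg₀K, hlim₀⟩ :=
    exists_subseq_tendsto_integral_mul_continuous_of_eBMOSeminorm_le (f := f 0)
      (fun k => hfBMO 0 k) (fun k => hfK 0 k)
  obtain ⟨σ₁, hσ₁, g₁, hg₁m, hg₁, hg₁K, hlim₁⟩ :=
    exists_subseq_tendsto_integral_mul_continuous_of_eBMOSeminorm_le (f := fun k => f 1 (σ₀ k))
      (fun k => hfBMO 1 _) (fun k => hfK 1 _)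
  obtain ⟨σ₂, hσ₂, g₂, hg₂m, hg₂, hg₂K, hlim₂⟩ :=
    exists_subseq_tendsto_integral_mul_continuous_of_eBMOSeminorm_le
      (f := fun k => f 2 (σ₀ (σ₁ k))) (fun k => hfBMO 2 _) (fun k => hfK 2 _)
  set σ : ℕ → ℕ := fun k => σ₀ (σ₁ (σ₂ k)) with hσdef
  have hσt : Tendsto σ atTop atTop :=
    hσ₀.tendsto_atTop.comp (hσ₁.tendsto_atTop.comp hσ₂.tendsto_atTop)
  set g : Fin 3 → EuclideanSpace ℝ (Fin 3) → ℝ := ![g₀, g₁, g₂] with hgdef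
  set c : Fin 3 → ℕ → ℝ := fun i k => ⨍ y in ball 0 1, f i (σ k) y with hcdef
  have hgBMO : ∀ i, MemBMO (g i) volume := fun i => by
    fin_cases i <;> simp [hgdef, hg₀, hg₁, hg₂]
  have hgK : ∀ i, eBMOSeminorm (g i) volume ≤ 2 * K := fun i => by
    fin_cases i <;> simp [hgdef, hg₀K, hg₁K, hg₂K]
  -- convergence of all three components along `σ`
  have hlim : ∀ (i : Fin 3) (ψ : EuclideanSpace ℝ (Fin 3) → ℝ), Continuous ψ → HasCompactSupport ψ →
      Tendsto (fun k => ∫ x, (f i (σ k) x - c i k) * ψ x) atTop (𝓝 (∫ x, g i x * ψ x)) := by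
    intro i ψ hψ hψc
    fin_cases i
    · -- component `0`: along the subsequence `σ₁ ∘ σ₂` of `σ₀`
      have h := (hlim₀ ψ hψ hψc).comp (hσ₁.tendsto_atTop.comp hσ₂.tendsto_atTop)
      exact h
    · have h := (hlim₁ ψ hψ hψc).comp hσ₂.tendsto_atTop
      exact h
    · exact hlim₂ ψ hψ hψc
  -- the limit stream function
  set Bu : EuclideanSpace ℝ (Fin 3) → EuclideanSpace ℝ (Fin 3) :=
    fun x => ∑ i, g i x • EuclideanSpace.single i (1 : ℝ) with hBu
  have hBu_apply : ∀ x i, ⟪Bu x, EuclideanSpace.single i (1 : ℝ)⟫ = g i x := fun x i => by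
    rw [← apply_eq_inner_single]
    simp [hBu, Fin.sum_univ_three]
    fin_cases i <;> simp
  have hBu_loc : LocallyIntegrable Bu volume := by
    refine locallyIntegrable_finsetSum _ fun i _ => ?_
    have h1 : LocallyIntegrable (fun x => g i x) volume := (hgBMO i).locallyIntegrable
    refine (MeasureTheory.LocallyIntegrable.smul h1 (‖EuclideanSpace.single i (1 : ℝ)‖)).mono
      (h1.aestronglyMeasurable.smul_const _) (Eventually.of_forall fun x => le_of_eq ?_)
    simp [norm_smul, mul_comm]
  -- the vector `BMO` bound of the limit stream function: `≤ Σᵢ ‖gᵢ‖_* ≤ 6K`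
  have hBu_bmo : eBMOSeminormVec Bu ≤ 6 * K := by
    refine iSup₂_le fun v hv => ?_
    have heq : (fun x => ⟪Bu x, v⟫) =
        fun x => ∑ i, ⟪EuclideanSpace.single i (1 : ℝ), v⟫ * g i x := by
      funext x
      simp only [hBu, sum_inner, real_inner_smul_left]
      exact Finset.sum_congr rfl fun i _ => mul_comm _ _
    rw [heq]
    have hli : ∀ i, LocallyIntegrable (fun x => ⟪EuclideanSpace.single i (1 : ℝ), v⟫ * g i x)
        volume := fun i => by
      simpa only [Pi.smul_def, smul_eq_mul] using (hgBMO i).locallyIntegrable.smul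
        ⟪EuclideanSpace.single i (1 : ℝ), v⟫
    have hcoef : ∀ i : Fin 3, ‖⟪EuclideanSpace.single i (1 : ℝ), v⟫‖ₑ ≤ 1 := fun i => by
      rw [Real.enorm_eq_ofReal_abs, ENNReal.ofReal_le_one]
      calc |⟪EuclideanSpace.single i (1 : ℝ), v⟫| ≤ ‖EuclideanSpace.single i (1 : ℝ)‖ * ‖v‖ :=
            abs_real_inner_le_norm _ _
        _ ≤ 1 * 1 := by gcongr; simp
        _ = 1 := one_mul 1
    calc eBMOSeminorm (fun x => ∑ i, ⟪EuclideanSpace.single i (1 : ℝ), v⟫ * g i x) volume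
        ≤ ∑ i, eBMOSeminorm (fun x => ⟪EuclideanSpace.single i (1 : ℝ), v⟫ * g i x) volume :=
          eBMOSeminorm_sum_le' fun i _ => hli i
      _ ≤ ∑ i, ‖⟪EuclideanSpace.single i (1 : ℝ), v⟫‖ₑ * eBMOSeminorm (g i) volume :=
          Finset.sum_le_sum fun i _ => eBMOSeminorm_const_mul_le _ _ _
      _ ≤ ∑ _i : Fin 3, (1 : ℝ≥0∞) * (2 * K) :=
          Finset.sum_le_sum fun i _ => mul_le_mul' (hcoef i) (hgK i)
      _ = 6 * K := by
          simp only [one_mul, Finset.sum_const, Finset.card_univ, Fintype.card_fin, nsmul_eq_mul]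
          push_cast; ring
  refine ⟨Bu, hBu_loc, hBu_bmo, fun φ e hφ hφc => ?_⟩
  -- the multipliers `ψᵢ = (∇φ × e)ᵢ`
  have hgradc : Continuous (gradient φ) := continuous_gradient_of_contDiff hφ
  have hgrads : HasCompactSupport (gradient φ) := by
    refine hφc.mono' fun x hx => ?_
    contrapose! hx
    simp only [mem_support, not_not]
    exact gradient_eq_zero_of_notMem_tsupport hx
  set ψ : Fin 3 → EuclideanSpace ℝ (Fin 3) → ℝ := fun i x => (cross (gradient φ x) e) i with hψ
  have hψc : ∀ i, Continuous (ψ i) := fun i =>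
    (PiLp.continuous_apply 2 _ i).comp ((crossCLM.continuous₂.comp₂ hgradc continuous_const))
  have hψs : ∀ i, HasCompactSupport (ψ i) := fun i => by
    refine hgrads.mono fun x hx => ?_
    contrapose! hx
    simp only [mem_support, not_not] at hx ⊢
    simp [hψ, hx, ← crossCLM_apply]
  -- the identity for each `k`, with the constants subtracted
  have hconst : ∀ (cv : EuclideanSpace ℝ (Fin 3)),
      ∫ x, ⟪cross cv (gradient φ x), e⟫ = 0 := by
    intro cv
    have h := integral_mul_inner_eq_integral_inner_cross_gradient (B := fun _ => cv)
      (w := fun _ => (0 : EuclideanSpace ℝ (Fin 3))) (differentiable_const cv)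
      (Eventually.of_forall fun x => by
        show curl (fun _ => cv) x = 0
        exact curl_eq_zero_of_fderiv_eq_zero (by simp)) (locallyIntegrable_const _) hφ hφc e
    simpa using h.symm
  have hk : ∀ k, ∫ x, φ x * ⟪w (σ k) x, e⟫ = ∑ i, ∫ x, (f i (σ k) x - c i k) * ψ i x := by
    intro k
    rw [integral_mul_inner_eq_integral_inner_cross_gradient (hB (σ k)) (hcurl (σ k)) (hw (σ k))
      hφ hφc e]
    set cv : EuclideanSpace ℝ (Fin 3) := ∑ i, c i k • EuclideanSpace.single i (1 : ℝ) with hcv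
    have hcv_apply : ∀ i, ⟪cv, EuclideanSpace.single i (1 : ℝ)⟫ = c i k := fun i => by
      rw [← apply_eq_inner_single]
      simp [hcv, Fin.sum_univ_three]
      fin_cases i <;> simp
    -- subtract the constant field
    have h1 : ∫ x, ⟪cross (B (σ k) x) (gradient φ x), e⟫ =
        ∫ x, ⟪cross (B (σ k) x - cv) (gradient φ x), e⟫ := by
      have hi1 : Integrable (fun x => ⟪cross (B (σ k) x - cv) (gradient φ x), e⟫) := by
        refine Continuous.integrable_of_hasCompactSupport ?_ ?_
        · exact (crossCLM.continuous₂.comp₂ ((hB (σ k)).continuous.sub continuous_const)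
            hgradc).inner continuous_const
        · refine hgrads.mono fun x hx => ?_
          contrapose! hx
          simp only [mem_support, not_not] at hx ⊢
          simp [hx, ← crossCLM_apply]
      have hi2 : Integrable (fun x => ⟪cross cv (gradient φ x), e⟫) := by
        refine Continuous.integrable_of_hasCompactSupport ?_ ?_
        · exact (crossCLM.continuous₂.comp₂ continuous_const hgradc).inner continuous_const
        · refine hgrads.mono fun x hx => ?_
          contrapose! hx
          simp only [mem_support, not_not] at hx ⊢
          simp [hx, ← crossCLM_apply]
      have hpt : ∀ x, ⟪cross (B (σ k) x) (gradient φ x), e⟫ =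
          ⟪cross (B (σ k) x - cv) (gradient φ x), e⟫ + ⟪cross cv (gradient φ x), e⟫ := fun x => by
        rw [← inner_add_left]
        congr 1
        simp [← crossCLM_apply, map_sub]
      simp_rw [hpt]
      rw [integral_add hi1 hi2, hconst cv, add_zero]
    rw [h1]
    -- expand in components
    have h2 : ∀ x, ⟪cross (B (σ k) x - cv) (gradient φ x), e⟫ =
        ∑ i, (f i (σ k) x - c i k) * ψ i x := fun x => by
      rw [inner_cross_left_eq_sum]
      refine Finset.sum_congr rfl fun i _ => ?_
      rw [inner_sub_left, hcv_apply]
    simp_rw [h2]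
    refine integral_finsetSum _ fun i _ => ?_
    exact ((((hB (σ k)).continuous.inner continuous_const).sub continuous_const).mul (hψc i))
      |>.integrable_of_hasCompactSupport (hψs i).mul_left
  -- the right-hand side of the limit identity in components
  have hrhs : ∫ x, ⟪cross (Bu x) (gradient φ x), e⟫ = ∑ i, ∫ x, g i x * ψ i x := by
    have h2 : ∀ x, ⟪cross (Bu x) (gradient φ x), e⟫ = ∑ i, g i x * ψ i x := fun x => by
      rw [inner_cross_left_eq_sum]
      refine Finset.sum_congr rfl fun i _ => ?_
      rw [hBu_apply]
    simp_rw [h2]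
    refine integral_finsetSum _ fun i _ => ?_
    have := (hgBMO i).locallyIntegrable.integrable_smul_left_of_hasCompactSupport (hψc i) (hψs i)
    exact this.congr (Eventually.of_forall fun x => by simp [smul_eq_mul, mul_comm])
  -- pass to the limit on both sides
  have hL : Tendsto (fun k => ∫ x, φ x * ⟪w (σ k) x, e⟫) atTop (𝓝 (∫ x, φ x * ⟪u x, e⟫)) :=
    (tendsto_integral_mul_inner_of_tendstoUniformlyOn hw hu hconv hφ.continuous hφc e).comp hσt
  have hR : Tendsto (fun k => ∫ x, φ x * ⟪w (σ k) x, e⟫) atTop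
      (𝓝 (∫ x, ⟪cross (Bu x) (gradient φ x), e⟫)) := by
    simp_rw [hk, hrhs]
    exact tendsto_finsetSum _ fun i _ => hlim i (ψ i) (hψc i) (hψs i)
  exact tendsto_nhds_unique hL hR

end Literature.Analysis.FluidPDE
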